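import Summits.QuantumFields.GaugeBoot.HaarTraceSmallBall
import HarnessLib

/-!
# Lattice non-abelian Stokes: the cost of a rectangular Wilson loop is at most `RT` times the total cost of its plaquettes (gauge-boot, ADDENDUM 23 part A)

HONEST FRAMING (cell `pub-gaugeboot`, page 1 of every file): the venture produces certified bounds
on lattice expectations at stated coupling, gauge group, dimension and torus size; NOT a mass gap,
NOT a continuum limit, NOT a string tension; NOT Yang–Mills-summit-bearing (barriers
`FixedCouplingUltralocality`, `PerturbativeInvisibility`).  A POINTWISE inequality between a Wilson loop and the plaquettes it
encloses; it certifies no number by itself.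

## Content (every group `G`, every continuous `N`-dimensional representation `ρ`, every torus `(ℤ/L)^d`, EVERY configuration)

The rectangle holonomy is a product of `RT` conjugated plaquette holonomies (lattice Stokes).  Instead of the word identity we run
the two recursions it consists of directly on the tree's `rectangleHolonomy` / `lineHolonomy`:
`rect(y; R+1, 1) = U_{y,i}·rect(y+e_i; R, 1)·U_{y,i}⁻¹·U_P(y)` (`rectangleHolonomy_succ_one`) and
`rect(x; R, T+1) = rect(x; R, T)·(P_T·rect(x+Te_j; R, 1)·P_T⁻¹)`, `P_T` the straight path `(+e_j)^T` (`rectangleHolonomy_succ`).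
With the Hilbert–Schmidt cost `‖1 − σ(g)‖` of the unitarised representation `σ` (`N − Re tr ρ(g) = ‖1 − σ(g)‖²/2`, tree), which is
subadditive (`‖1 − UV‖ ≤ ‖1 − U‖ + ‖1 − V‖`, Chatterjee's Lemma 7.4 in the tree) and conjugation invariant, and Cauchy–Schwarz:

* ★★★ `sub_re_trace_rectangleHolonomy_le` — **`N − Re tr ρ(hol ∂(R×T)) ≤ R·T·Σ_{t<T} Σ_{k<R} (N − Re tr ρ(U_P(x + k e_i + t e_j)))`**
  for EVERY configuration `U`, every base point, every pair of axes, every `R, T` (no size condition: an algebraic identity of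
  holonomies plus a norm inequality);
* ★★★ `one_sub_wilsonLoop_le` — `1 − W_{R×T}(U) ≤ R·T·Σ_{t,k} (1 − u_{P(x + k e_i + t e_j)}(U))` (`N ≥ 1`).

Integrated forms (every torus Wilson state, every limit point: `1 − ⟨W̄(R×T)⟩ ≤ (RT)²(1 − ⟨ū_P⟩)`, hence `1 − O((RT)²/β)` at weak
coupling on EVERY torus) are in `LatticeStokesWilsonLoops`.  References: K. G. Wilson, Phys. Rev. D 10 (1974) (lattice Stokes);
S. Chatterjee, arXiv:1602.01222 §7 (Hilbert–Schmidt lemmas, in the tree).  Everything is `[folklore]`.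
-/

noncomputable section

open scoped Matrix.Norms.Frobenius
open Literature.MathematicalPhysics.QuantumFieldTheory
open Literature.RepresentationTheory.CompactGroups
open Literature.RepresentationTheory.CompactGroups.CompactGroup (unitarize unitarize_mem_unitaryGroup)

namespace Summit.QuantumFields.GaugeBoot

namespace LatticeStokes

variable {d L N : ℕ} {G : Type*} [Group G]

/-! ## The two recursions of the rectangle holonomy -/

/-- A straight path of one step is the link. [folklore] -/
theorem lineHolonomy_one (U : GaugeConfig d L G) (k : Fin d) (y : Site d L) : lineHolonomy U k 1 y = U (y, k) := by
  simp [lineHolonomy]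

/-- `(R : ℤ/L) e_i + e_i = (R + 1) e_i` on sites. [folklore] -/
theorem add_single_natCast_succ (y : Site d L) (i : Fin d) (R : ℕ) :
    y + Pi.single i (1 : ZMod L) + Pi.single i ((R : ℕ) : ZMod L) = y + Pi.single i (((R + 1 : ℕ) : ℕ) : ZMod L) := by
  rw [add_assoc, ← Pi.single_add]; congr 2; push_cast; ring

/-- **The strip recursion**: `rect(y; R+1, 1) = U_{y,i} · rect(y + e_i; R, 1) · U_{y,i}⁻¹ · U_P(y)` — peel the first plaquette
of a one-row strip. [folklore] -/
theorem rectangleHolonomy_succ_one (U : GaugeConfig d L G) (y : Site d L) (i j : Fin d) (R : ℕ) :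
    rectangleHolonomy U y i j (R + 1) 1 =
      U (y, i) * rectangleHolonomy U (y.shift i) i j R 1 * (U (y, i))⁻¹ * plaquetteHolonomy U y i j := by
  have e1 : (y.shift i) + Pi.single i ((R : ℕ) : ZMod L) = y + Pi.single i (((R + 1 : ℕ) : ℕ) : ZMod L) := by
    rw [Site.shift]; exact add_single_natCast_succ y i R
  have e2 : (y + Pi.single j ((1 : ℕ) : ZMod L)) = y.shift j := by simp [Site.shift]
  have e3 : (y.shift i + Pi.single j ((1 : ℕ) : ZMod L)) = (y.shift j).shift i := by
    simp only [Site.shift, Nat.cast_one]; abel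
  have hL : rectangleHolonomy U y i j (R + 1) 1 = (U (y, i) * lineHolonomy U i R (y.shift i)) *
      U (y + Pi.single i (((R + 1 : ℕ) : ℕ) : ZMod L), j) * (U (y.shift j, i) * lineHolonomy U i R ((y.shift j).shift i))⁻¹ *
        (U (y, j))⁻¹ := by
    rw [rectangleHolonomy, lineHolonomy_one, lineHolonomy_one, e2, lineHolonomy, lineHolonomy]
  have hR : rectangleHolonomy U (y.shift i) i j R 1 = lineHolonomy U i R (y.shift i) *
      U (y + Pi.single i (((R + 1 : ℕ) : ℕ) : ZMod L), j) * (lineHolonomy U i R ((y.shift j).shift i))⁻¹ * (U (y.shift i, j))⁻¹ := by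
    rw [rectangleHolonomy, lineHolonomy_one, lineHolonomy_one, e1, e3]
  rw [hL, hR, plaquetteHolonomy]
  group

/-- **The row recursion**: `rect(x; R, T+1) = rect(x; R, T) · (P_T · rect(x + T e_j; R, 1) · P_T⁻¹)` with `P_T` the holonomy of the
straight path `(+e_j)^T` from `x` — add the top row. [folklore] -/
theorem rectangleHolonomy_succ (U : GaugeConfig d L G) (x : Site d L) (i j : Fin d) (R T : ℕ) :
    rectangleHolonomy U x i j R (T + 1) =
      rectangleHolonomy U x i j R T * (lineHolonomy U j T x *
        rectangleHolonomy U (x + Pi.single j ((T : ℕ) : ZMod L)) i j R 1 * (lineHolonomy U j T x)⁻¹) := by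
  have e1 : x + Pi.single j ((T : ℕ) : ZMod L) + Pi.single i ((R : ℕ) : ZMod L) =
      x + Pi.single i ((R : ℕ) : ZMod L) + Pi.single j ((T : ℕ) : ZMod L) := by abel
  have e2 : x + Pi.single j ((T : ℕ) : ZMod L) + Pi.single j ((1 : ℕ) : ZMod L) = x + Pi.single j (((T + 1 : ℕ) : ℕ) : ZMod L) := by
    rw [add_assoc, ← Pi.single_add]; congr 2; push_cast; ring
  have hB : lineHolonomy U j (T + 1) (x + Pi.single i ((R : ℕ) : ZMod L)) = lineHolonomy U j T (x + Pi.single i ((R : ℕ) : ZMod L)) *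
      U (x + Pi.single i ((R : ℕ) : ZMod L) + Pi.single j ((T : ℕ) : ZMod L), j) := WilsonLoopRP.lineHolonomy_succ_right U j T _
  have hD : lineHolonomy U j (T + 1) x = lineHolonomy U j T x * U (x + Pi.single j ((T : ℕ) : ZMod L), j) :=
    WilsonLoopRP.lineHolonomy_succ_right U j T x
  have hS : rectangleHolonomy U (x + Pi.single j ((T : ℕ) : ZMod L)) i j R 1 =
      lineHolonomy U i R (x + Pi.single j ((T : ℕ) : ZMod L)) * U (x + Pi.single i ((R : ℕ) : ZMod L) + Pi.single j ((T : ℕ) : ZMod L), j) *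
        (lineHolonomy U i R (x + Pi.single j (((T + 1 : ℕ) : ℕ) : ZMod L)))⁻¹ * (U (x + Pi.single j ((T : ℕ) : ZMod L), j))⁻¹ := by
    rw [rectangleHolonomy, lineHolonomy_one, lineHolonomy_one, e1, e2]
  rw [rectangleHolonomy, rectangleHolonomy, hB, hD, hS]
  group

/-! ## Hilbert–Schmidt costs -/

section Cost

variable [TopologicalSpace G] [IsTopologicalGroup G] [CompactSpace G] (ρ : G →* Matrix (Fin N) (Fin N) ℂ)

/-- The unitarised representation as a homomorphism into `U(N)`. [folklore] -/
theorem coe_unitarizeHom (hρ : Continuous ρ) (g : G) :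
    (((unitarize ρ hρ).codRestrict (Matrix.unitaryGroup (Fin N) ℂ) (unitarize_mem_unitaryGroup ρ hρ) g :
      Matrix.unitaryGroup (Fin N) ℂ) : Matrix (Fin N) (Fin N) ℂ) = unitarize ρ hρ g := rfl

/-- **Subadditivity of the Hilbert–Schmidt cost**: `‖1 − σ(ab)‖ ≤ ‖1 − σ(a)‖ + ‖1 − σ(b)‖`. [folklore] -/
theorem norm_one_sub_unitarize_mul_le (hρ : Continuous ρ) (a b : G) :
    ‖(1 : Matrix (Fin N) (Fin N) ℂ) - unitarize ρ hρ (a * b)‖ ≤ ‖(1 : Matrix (Fin N) (Fin N) ℂ) - unitarize ρ hρ a‖ +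
      ‖(1 : Matrix (Fin N) (Fin N) ℂ) - unitarize ρ hρ b‖ := by
  set σ := (unitarize ρ hρ).codRestrict (Matrix.unitaryGroup (Fin N) ℂ) (unitarize_mem_unitaryGroup ρ hρ)
  have h := UnitaryCayley.norm_one_sub_mul_le (σ a) (unitarize ρ hρ b)
  rw [coe_unitarizeHom, ← map_mul] at h
  exact h

/-- **Conjugation invariance of the Hilbert–Schmidt cost**: `‖1 − σ(hgh⁻¹)‖ = ‖1 − σ(g)‖`. [folklore] -/
theorem norm_one_sub_unitarize_conj (hρ : Continuous ρ) (h g : G) :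
    ‖(1 : Matrix (Fin N) (Fin N) ℂ) - unitarize ρ hρ (h * g * h⁻¹)‖ = ‖(1 : Matrix (Fin N) (Fin N) ℂ) - unitarize ρ hρ g‖ := by
  set σ := (unitarize ρ hρ).codRestrict (Matrix.unitaryGroup (Fin N) ℂ) (unitarize_mem_unitaryGroup ρ hρ)
  have e : (1 : Matrix (Fin N) (Fin N) ℂ) - unitarize ρ hρ (h * g * h⁻¹) =
      ((σ h : Matrix.unitaryGroup (Fin N) ℂ) : Matrix (Fin N) (Fin N) ℂ) * ((1 : Matrix (Fin N) (Fin N) ℂ) - unitarize ρ hρ g) *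
        ((σ h⁻¹ : Matrix.unitaryGroup (Fin N) ℂ) : Matrix (Fin N) (Fin N) ℂ) := by
    rw [Matrix.mul_sub, Matrix.sub_mul, Matrix.mul_one, coe_unitarizeHom, coe_unitarizeHom, ← map_mul, ← map_mul, ← map_mul,
      mul_inv_cancel, map_one]
  rw [e, Matrix.frobenius_norm_mul_unitaryGroup, Matrix.frobenius_norm_unitaryGroup_mul]

/-- **The cost of a one-row strip**: `‖1 − σ(rect(y; R, 1))‖ ≤ Σ_{k<R} ‖1 − σ(U_P(y + k e_i))‖`. [folklore] -/
theorem norm_one_sub_unitarize_strip_le (hρ : Continuous ρ) (U : GaugeConfig d L G) (i j : Fin d) :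
    ∀ (R : ℕ) (y : Site d L), ‖(1 : Matrix (Fin N) (Fin N) ℂ) - unitarize ρ hρ (rectangleHolonomy U y i j R 1)‖ ≤
      ∑ k ∈ Finset.range R, ‖(1 : Matrix (Fin N) (Fin N) ℂ) -
        unitarize ρ hρ (plaquetteHolonomy U (y + Pi.single i ((k : ℕ) : ZMod L)) i j)‖
  | 0, y => by
    simp [rectangleHolonomy, lineHolonomy]
  | R + 1, y => by
    rw [rectangleHolonomy_succ_one, Finset.sum_range_succ', Nat.cast_zero, Pi.single_zero, add_zero]
    refine (norm_one_sub_unitarize_mul_le ρ hρ _ _).trans (add_le_add ?_ le_rfl)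
    rw [norm_one_sub_unitarize_conj ρ hρ]
    refine (norm_one_sub_unitarize_strip_le hρ U i j R (y.shift i)).trans (le_of_eq (Finset.sum_congr rfl fun k _ => ?_))
    rw [Site.shift, add_single_natCast_succ]

/-- **The cost of a rectangle**: `‖1 − σ(rect(x; R, T))‖ ≤ Σ_{t<T} Σ_{k<R} ‖1 − σ(U_P(x + k e_i + t e_j))‖` — lattice Stokes at the
level of Hilbert–Schmidt costs. [folklore] -/
theorem norm_one_sub_unitarize_rectangle_le (hρ : Continuous ρ) (U : GaugeConfig d L G) (x : Site d L) (i j : Fin d) (R : ℕ) :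
    ∀ T : ℕ, ‖(1 : Matrix (Fin N) (Fin N) ℂ) - unitarize ρ hρ (rectangleHolonomy U x i j R T)‖ ≤
      ∑ t ∈ Finset.range T, ∑ k ∈ Finset.range R, ‖(1 : Matrix (Fin N) (Fin N) ℂ) -
        unitarize ρ hρ (plaquetteHolonomy U (x + Pi.single i ((k : ℕ) : ZMod L) + Pi.single j ((t : ℕ) : ZMod L)) i j)‖
  | 0 => by simp [rectangleHolonomy, lineHolonomy]
  | T + 1 => by
    rw [rectangleHolonomy_succ, Finset.sum_range_succ]
    refine (norm_one_sub_unitarize_mul_le ρ hρ _ _).trans (add_le_add (norm_one_sub_unitarize_rectangle_le hρ U x i j R T) ?_)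
    rw [norm_one_sub_unitarize_conj ρ hρ]
    refine (norm_one_sub_unitarize_strip_le ρ hρ U i j R _).trans (le_of_eq (Finset.sum_congr rfl fun k _ => ?_))
    congr 3; abel

/-! ## The lattice Stokes bound -/

/-- ★★★ **LATTICE NON-ABELIAN STOKES BOUND.**  For every group `G`, every continuous `N`-dimensional representation `ρ`, every
configuration `U` on the torus `(ℤ/L)^d`, every base point `x`, axes `i, j` and `R, T`:
`N − Re tr ρ(hol ∂(R×T)) ≤ R·T·Σ_{t<T} Σ_{k<R} (N − Re tr ρ(U_P(x + k e_i + t e_j)))`. [folklore] -/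
theorem sub_re_trace_rectangleHolonomy_le (hρ : Continuous ρ) (U : GaugeConfig d L G) (x : Site d L) (i j : Fin d) (R T : ℕ) :
    (N : ℝ) - ((ρ (rectangleHolonomy U x i j R T)).trace).re ≤
      (R : ℝ) * T * ∑ t ∈ Finset.range T, ∑ k ∈ Finset.range R,
        ((N : ℝ) - ((ρ (plaquetteHolonomy U (x + Pi.single i ((k : ℕ) : ZMod L) + Pi.single j ((t : ℕ) : ZMod L)) i j)).trace).re) := by
  have key : ∑ t ∈ Finset.range T, ∑ k ∈ Finset.range R,
      ((N : ℝ) - ((ρ (plaquetteHolonomy U (x + Pi.single i ((k : ℕ) : ZMod L) + Pi.single j ((t : ℕ) : ZMod L)) i j)).trace).re) =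
      ∑ t ∈ Finset.range T, ∑ k ∈ Finset.range R, ‖(1 : Matrix (Fin N) (Fin N) ℂ) -
        unitarize ρ hρ (plaquetteHolonomy U (x + Pi.single i ((k : ℕ) : ZMod L) + Pi.single j ((t : ℕ) : ZMod L)) i j)‖ ^ 2 / 2 :=
    Finset.sum_congr rfl fun t _ => Finset.sum_congr rfl fun k _ => HaarCovering.sub_re_trace_eq_norm_sq ρ hρ _
  rw [HaarCovering.sub_re_trace_eq_norm_sq ρ hρ (rectangleHolonomy U x i j R T), key]
  have h := norm_one_sub_unitarize_rectangle_le ρ hρ U x i j R T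
  have h0 : 0 ≤ ‖(1 : Matrix (Fin N) (Fin N) ℂ) - unitarize ρ hρ (rectangleHolonomy U x i j R T)‖ := norm_nonneg _
  -- Cauchy–Schwarz over the `RT` plaquettes: `(Σ a)² ≤ RT · Σ a²`
  have hcs : ∀ a : ℕ → ℕ → ℝ, (∑ t ∈ Finset.range T, ∑ k ∈ Finset.range R, a t k) ^ 2 ≤
      (R : ℝ) * T * ∑ t ∈ Finset.range T, ∑ k ∈ Finset.range R, a t k ^ 2 := fun a => by
    have h1 := sq_sum_le_card_mul_sum_sq (s := Finset.range T) (f := fun t => ∑ k ∈ Finset.range R, a t k)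
    have h2 : ∀ t, (∑ k ∈ Finset.range R, a t k) ^ 2 ≤ R * ∑ k ∈ Finset.range R, a t k ^ 2 := fun t => by
      have h := sq_sum_le_card_mul_sum_sq (s := Finset.range R) (f := fun k => a t k)
      rwa [Finset.card_range] at h
    rw [Finset.card_range] at h1
    calc (∑ t ∈ Finset.range T, ∑ k ∈ Finset.range R, a t k) ^ 2
        ≤ T * ∑ t ∈ Finset.range T, (∑ k ∈ Finset.range R, a t k) ^ 2 := h1
      _ ≤ T * ∑ t ∈ Finset.range T, (R * ∑ k ∈ Finset.range R, a t k ^ 2) := by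
          gcongr with t _
          exact h2 t
      _ = (R : ℝ) * T * ∑ t ∈ Finset.range T, ∑ k ∈ Finset.range R, a t k ^ 2 := by rw [← Finset.mul_sum]; ring
  have hcs' := hcs fun t k => ‖(1 : Matrix (Fin N) (Fin N) ℂ) -
    unitarize ρ hρ (plaquetteHolonomy U (x + Pi.single i ((k : ℕ) : ZMod L) + Pi.single j ((t : ℕ) : ZMod L)) i j)‖
  beta_reduce at hcs'
  have hmain := (pow_le_pow_left₀ h0 h 2).trans hcs'
  have hsplit : (R : ℝ) * T * ∑ t ∈ Finset.range T, ∑ k ∈ Finset.range R, ‖(1 : Matrix (Fin N) (Fin N) ℂ) -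
      unitarize ρ hρ (plaquetteHolonomy U (x + Pi.single i ((k : ℕ) : ZMod L) + Pi.single j ((t : ℕ) : ZMod L)) i j)‖ ^ 2 / 2 =
      ((R : ℝ) * T * ∑ t ∈ Finset.range T, ∑ k ∈ Finset.range R, ‖(1 : Matrix (Fin N) (Fin N) ℂ) -
        unitarize ρ hρ (plaquetteHolonomy U (x + Pi.single i ((k : ℕ) : ZMod L) + Pi.single j ((t : ℕ) : ZMod L)) i j)‖ ^ 2) / 2 := by
    rw [mul_div_assoc, Finset.sum_div]
    congr 1
    exact Finset.sum_congr rfl fun t _ => (Finset.sum_div _ _ _).symm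
  rw [hsplit]
  exact div_le_div_of_nonneg_right hmain (by norm_num)

/-- ★★★ **Wilson-loop form**: `1 − W_{R×T}(U) ≤ R·T·Σ_{t<T} Σ_{k<R} (1 − u_P(x + k e_i + t e_j)(U))` for every configuration
(`N ≥ 1`; `W = (1/N)Re tr`, `u_P = plaquetteTrace`). [folklore] -/
theorem one_sub_wilsonLoop_le (hρ : Continuous ρ) (hN : N ≠ 0) (U : GaugeConfig d L G) (x : Site d L) (i j : Fin d) (R T : ℕ) :
    1 - wilsonLoop ρ x i j R T U ≤
      (R : ℝ) * T * ∑ t ∈ Finset.range T, ∑ k ∈ Finset.range R,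
        (1 - plaquetteTrace ρ (x + Pi.single i ((k : ℕ) : ZMod L) + Pi.single j ((t : ℕ) : ZMod L)) i j U) := by
  have hNpos : (0 : ℝ) < N := by exact_mod_cast Nat.pos_of_ne_zero hN
  have hN' : (N : ℝ) ≠ 0 := hNpos.ne'
  have h := sub_re_trace_rectangleHolonomy_le ρ hρ U x i j R T
  have e0 : ∀ X : ℝ, 1 - (N : ℝ)⁻¹ * X = (N : ℝ)⁻¹ * ((N : ℝ) - X) := fun X => by rw [mul_sub, inv_mul_cancel₀ hN']
  have e1 : 1 - wilsonLoop ρ x i j R T U = (N : ℝ)⁻¹ * ((N : ℝ) - ((ρ (rectangleHolonomy U x i j R T)).trace).re) := e0 _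
  have key : ∑ t ∈ Finset.range T, ∑ k ∈ Finset.range R,
      (1 - plaquetteTrace ρ (x + Pi.single i ((k : ℕ) : ZMod L) + Pi.single j ((t : ℕ) : ZMod L)) i j U) =
      ∑ t ∈ Finset.range T, ∑ k ∈ Finset.range R, (N : ℝ)⁻¹ * ((N : ℝ) -
        ((ρ (plaquetteHolonomy U (x + Pi.single i ((k : ℕ) : ZMod L) + Pi.single j ((t : ℕ) : ZMod L)) i j)).trace).re) :=
    Finset.sum_congr rfl fun t _ => Finset.sum_congr rfl fun k _ => e0 _
  rw [e1, key]
  have hR : (N : ℝ)⁻¹ * ((R : ℝ) * T * ∑ t ∈ Finset.range T, ∑ k ∈ Finset.range R, ((N : ℝ) -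
      ((ρ (plaquetteHolonomy U (x + Pi.single i ((k : ℕ) : ZMod L) + Pi.single j ((t : ℕ) : ZMod L)) i j)).trace).re)) =
      (R : ℝ) * T * ∑ t ∈ Finset.range T, ∑ k ∈ Finset.range R, (N : ℝ)⁻¹ * ((N : ℝ) -
        ((ρ (plaquetteHolonomy U (x + Pi.single i ((k : ℕ) : ZMod L) + Pi.single j ((t : ℕ) : ZMod L)) i j)).trace).re) := by
    rw [mul_left_comm, Finset.mul_sum]
    congr 1
    exact Finset.sum_congr rfl fun t _ => Finset.mul_sum _ _ _
  rw [← hR]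
  exact mul_le_mul_of_nonneg_left h (inv_nonneg.2 hNpos.le)

end Cost

end LatticeStokes

end Summit.QuantumFields.GaugeBoot

end
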